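import Literature.AlgebraicTopology.Homotopy.IteratedSuspension
import Literature.AlgebraicTopology.SingularHomology.SphereComplement
import HarnessLib

/-!
# The suspension of a sphere is a sphere: `S(Sⁿ) ≅ Sⁿ⁺¹`

Topic `Literature/AlgebraicTopology/Homotopy`. A. Hatcher, *Algebraic Topology* (2002), Ch. 0
p. 8: "`SX` … when `X = Sⁿ`, `SX = Sⁿ⁺¹` with the two 'suspension points' at the north and south
poles". For the tree's unreduced suspension `Susp` (`UnreducedSuspension.lean`) and the metric unit
spheres `Sⁿ ⊂ ℝⁿ⁺¹ = EuclideanSpace ℝ (Fin (n+1))` we DEFINE the comparison map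
`[d, t] ↦ (2√(t(1-t))·d, 2t - 1)` and PROVE that it is a homeomorphism:

* `SuspSphere.coef t = 2√(t(1-t))` and its algebra (`coef_sq : coef t ² = 1 - (2t-1)²`);
* `SuspSphere.toSphere n : C(Susp (𝕊 n), 𝕊 (n+1))`, `toSphere_mk`, bijective;
* **`SuspSphere.homeomorph n : Susp (𝕊 n) ≃ₜ 𝕊 (n + 1)`**;
* `SuspSphere.ballMap n : C(Susp (closedBall 0 1), ℝⁿ⁺²)` — the same formula on the suspension of
  the closed unit ball of `ℝⁿ⁺¹` (used to extend maps from the "equatorial belt" of `S(Dⁿ⁺¹)`).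

Everything is proved; no named facts.

## References

* A. Hatcher, *Algebraic Topology*, CUP (2002), Ch. 0 p. 8. [HatcherAT2002]
-/

noncomputable section

open Set Function Metric Topology unitInterval
open scoped Topology unitInterval
open Literature.AlgebraicTopology.SingularHomology.SphereComplement

namespace Literature.AlgebraicTopology.Homotopy

namespace SuspSphere

/-- Local notation: `𝔼 n` is `EuclideanSpace ℝ (Fin n)`. -/
local notation "𝔼 " n:arg => EuclideanSpace ℝ (Fin n)

/-- Local notation: `𝕊 n` is the unit sphere of `EuclideanSpace ℝ (Fin (n + 1))`. -/
local notation "𝕊 " n:arg => (Metric.sphere (0 : EuclideanSpace ℝ (Fin (n + 1))) 1)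

variable {n : ℕ}

/-! ### The radial coefficient `2√(t(1 - t))` -/

/-- `coef t = 2√(t(1 - t))`, the radius of the parallel of height `2t - 1` on the unit sphere.
[folklore] -/
def coef (t : I) : ℝ := 2 * Real.sqrt (t * (1 - t))

/-- `coef` is continuous. [folklore] -/
theorem continuous_coef : Continuous coef :=
  continuous_const.mul (Real.continuous_sqrt.comp
    (continuous_subtype_val.mul (continuous_const.sub continuous_subtype_val)))

/-- `t(1 - t) ≥ 0` on `[0, 1]`. [folklore] -/
theorem mul_one_sub_nonneg (t : I) : 0 ≤ (t : ℝ) * (1 - t) := mul_nonneg t.2.1 (by linarith [t.2.2])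

/-- `coef t ≥ 0`. [folklore] -/
theorem coef_nonneg (t : I) : 0 ≤ coef t := mul_nonneg (by norm_num) (Real.sqrt_nonneg _)

/-- `coef t ² = 4 t (1 - t) = 1 - (2t - 1)²`. [folklore] -/
theorem coef_sq (t : I) : coef t ^ 2 = 1 - (2 * (t : ℝ) - 1) ^ 2 := by
  unfold coef
  rw [mul_pow, Real.sq_sqrt (mul_one_sub_nonneg t)]
  ring

/-- `coef 0 = 0`. [folklore] -/
@[simp] theorem coef_zero : coef 0 = 0 := by simp [coef]

/-- `coef 1 = 0`. [folklore] -/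
@[simp] theorem coef_one : coef 1 = 0 := by simp [coef]

/-- `coef t = 0` only at the end points. [folklore] -/
theorem eq_zero_or_eq_one_of_coef_eq_zero {t : I} (h : coef t = 0) : t = 0 ∨ t = 1 := by
  unfold coef at h
  have h1 : Real.sqrt ((t : ℝ) * (1 - t)) = 0 := by
    rcases mul_eq_zero.1 h with h2 | h2
    · norm_num at h2
    · exact h2
  rw [Real.sqrt_eq_zero (mul_one_sub_nonneg t)] at h1
  rcases mul_eq_zero.1 h1 with h0 | h0
  · exact Or.inl (Subtype.ext h0)
  · exact Or.inr (Subtype.ext (by rw [Set.Icc.coe_one]; linarith))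

/-! ### The comparison map -/

/-- The formula `(d, t) ↦ (coef t · d, 2t - 1) ∈ ℝⁿ⁺²` on `ℝⁿ⁺¹ × [0, 1]`. [folklore] -/
def liftVec (x : (𝔼 (n + 1)) × I) : 𝔼 (n + 2) := snocE (coef x.2 • x.1) (2 * (x.2 : ℝ) - 1)

/-- `liftVec` is continuous. [folklore] -/
theorem continuous_liftVec : Continuous (liftVec : (𝔼 (n + 1)) × I → 𝔼 (n + 2)) :=
  continuous_snocE.comp (((continuous_coef.comp continuous_snd).smul continuous_fst).prodMk
    ((continuous_const.mul (continuous_subtype_val.comp continuous_snd)).sub continuous_const))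

/-- `‖liftVec (d, t)‖² = coef t ² ‖d‖² + (2t - 1)²`. [folklore] -/
theorem norm_liftVec_sq (x : (𝔼 (n + 1)) × I) :
    ‖liftVec x‖ ^ 2 = coef x.2 ^ 2 * ‖x.1‖ ^ 2 + (2 * (x.2 : ℝ) - 1) ^ 2 := by
  unfold liftVec
  rw [norm_snocE_sq, norm_smul, mul_pow, Real.norm_of_nonneg (coef_nonneg _)]

/-- The formula respects the identifications of the suspension: at `t = 0` and `t = 1` the
`d`-coordinate is killed. [folklore] -/
theorem liftVec_eq_of_rel {P : Set (𝔼 (n + 1))} {x y : ↥P × I} (h : (suspSetoid ↥P).r x y) :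
    liftVec ((x.1 : 𝔼 (n + 1)), x.2) = liftVec ((y.1 : 𝔼 (n + 1)), y.2) := by
  rcases h with rfl | ⟨hx, hy⟩ | ⟨hx, hy⟩
  · rfl
  · unfold liftVec; simp [hx, hy]
  · unfold liftVec; simp [hx, hy]

/-- **The comparison map `S(Sⁿ) → Sⁿ⁺¹`**, `[d, t] ↦ (2√(t(1-t))·d, 2t - 1)` (Hatcher 2002,
Ch. 0 p. 8: `SSⁿ = Sⁿ⁺¹`). [cite: HatcherAT2002, Ch. 0 p. 8] -/
def toSphere (n : ℕ) : C(Susp (𝕊 n), 𝕊 (n + 1)) where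
  toFun := Quotient.lift (fun x : (𝕊 n) × I => (⟨liftVec ((x.1 : 𝔼 (n + 1)), x.2), by
      have h := norm_liftVec_sq ((x.1 : 𝔼 (n + 1)), x.2)
      rw [norm_eq_of_mem_sphere x.1, one_pow, mul_one, coef_sq] at h
      rw [mem_sphere_zero_iff_norm]
      nlinarith [norm_nonneg (liftVec ((x.1 : 𝔼 (n + 1)), x.2))]⟩ : 𝕊 (n + 1)))
    fun x y hxy => Subtype.ext (liftVec_eq_of_rel hxy)
  continuous_toFun := by
    rw [Susp.isQuotientMap_mk.continuous_iff]
    exact (continuous_liftVec.comp ((continuous_subtype_val.comp continuous_fst).prodMk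
      continuous_snd)).subtype_mk _

/-- `toSphere` on points. [folklore] -/
@[simp]
theorem coe_toSphere_mk (x : (𝕊 n) × I) :
    ((toSphere n (Susp.mk x) : 𝕊 (n + 1)) : 𝔼 (n + 2)) = liftVec ((x.1 : 𝔼 (n + 1)), x.2) := rfl

/-- `toSphere` is one-to-one. [folklore] -/
theorem toSphere_injective : Injective (toSphere n) := by
  intro z z' h
  induction z using Susp.ind with
  | h x =>
    induction z' using Susp.ind with
    | h x' =>
      have h' : liftVec ((x.1 : 𝔼 (n + 1)), x.2) = liftVec ((x'.1 : 𝔼 (n + 1)), x'.2) :=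
        congrArg (fun z : 𝕊 (n + 1) => (z : 𝔼 (n + 2))) h
      unfold liftVec at h'
      have ht : 2 * (x.2 : ℝ) - 1 = 2 * (x'.2 : ℝ) - 1 := by
        simpa using congrArg (fun v : 𝔼 (n + 2) => v (Fin.last (n + 1))) h'
      have ht' : x.2 = x'.2 := Subtype.ext (by linarith)
      have hd : coef x.2 • (x.1 : 𝔼 (n + 1)) = coef x'.2 • (x'.1 : 𝔼 (n + 1)) := snocE_injective_left h'
      obtain ⟨d, t⟩ := x
      obtain ⟨d', t'⟩ := x'
      simp only at ht' hd
      subst ht'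
      by_cases hc : coef t = 0
      · rcases eq_zero_or_eq_one_of_coef_eq_zero hc with rfl | rfl
        · exact Susp.mk_eq_mk_iff.2 (Or.inr (Or.inl ⟨rfl, rfl⟩))
        · exact Susp.mk_eq_mk_iff.2 (Or.inr (Or.inr ⟨rfl, rfl⟩))
      · have : (d : 𝔼 (n + 1)) = d' := smul_right_injective _ hc hd
        rw [Subtype.ext this]

/-- `toSphere` is onto. [folklore] -/
theorem toSphere_surjective : Surjective (toSphere n) := by
  intro y
  -- height and horizontal part of `y`
  set s : ℝ := (y : 𝔼 (n + 2)) (Fin.last (n + 1)) with hs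
  set v : 𝔼 (n + 1) := initE (y : 𝔼 (n + 2)) with hv
  have hy1 : ‖(y : 𝔼 (n + 2))‖ = 1 := norm_eq_of_mem_sphere y
  have hvs : ‖v‖ ^ 2 + s ^ 2 = 1 := by
    have h := norm_sq_eq_norm_initE_sq_add (y : 𝔼 (n + 2))
    rw [hy1, one_pow] at h
    exact h.symm
  have hs1 : -1 ≤ s ∧ s ≤ 1 := by constructor <;> nlinarith [norm_nonneg v]
  let t : I := ⟨(s + 1) / 2, by constructor <;> linarith [hs1.1, hs1.2]⟩
  have hct : coef t = ‖v‖ := by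
    have h1 : coef t ^ 2 = ‖v‖ ^ 2 := by
      rw [coef_sq]
      show 1 - (2 * ((s + 1) / 2) - 1) ^ 2 = ‖v‖ ^ 2
      nlinarith [hvs]
    nlinarith [coef_nonneg t, norm_nonneg v, sq_nonneg (coef t - ‖v‖), sq_nonneg (coef t + ‖v‖)]
  have h2t : 2 * (t : ℝ) - 1 = s := by show 2 * ((s + 1) / 2) - 1 = s; ring
  by_cases hv0 : v = 0
  · -- a pole: any `d` will do
    let d : 𝕊 n := ⟨EuclideanSpace.single (0 : Fin (n + 1)) (1 : ℝ), by simp⟩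
    refine ⟨Susp.mk (d, t), Subtype.ext ?_⟩
    rw [coe_toSphere_mk]
    unfold liftVec
    have hc0 : coef t = 0 := by rw [hct, hv0, norm_zero]
    simp only [hc0, zero_smul, h2t]
    rw [← hv0, hv, hs, snocE_initE]
  · have hvn : ‖v‖ ≠ 0 := norm_ne_zero_iff.2 hv0
    let d : 𝕊 n := ⟨‖v‖⁻¹ • v, by
      rw [mem_sphere_zero_iff_norm, norm_smul, norm_inv, norm_norm, inv_mul_cancel₀ hvn]⟩
    refine ⟨Susp.mk (d, t), Subtype.ext ?_⟩
    rw [coe_toSphere_mk]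
    unfold liftVec
    have hcd : coef t • ((d : 𝕊 n) : 𝔼 (n + 1)) = v := by
      show coef t • (‖v‖⁻¹ • v) = v
      rw [hct, smul_smul, mul_inv_cancel₀ hvn, one_smul]
    simp only [hcd, h2t]
    rw [hv, hs, snocE_initE]

/-- **`S(Sⁿ) ≅ Sⁿ⁺¹`** (Hatcher 2002, Ch. 0 p. 8), the comparison map being a continuous bijection
from a compact space to a Hausdorff space. [cite: HatcherAT2002, Ch. 0 p. 8] -/
def homeomorph (n : ℕ) : Susp (𝕊 n) ≃ₜ 𝕊 (n + 1) :=
  Continuous.homeoOfEquivCompactToT2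
    (f := Equiv.ofBijective (toSphere n) ⟨toSphere_injective, toSphere_surjective⟩) (toSphere n).continuous

/-- The homeomorphism is `toSphere` as a function. [folklore] -/
@[simp]
theorem coe_homeomorph : ⇑(homeomorph n) = toSphere n := rfl

/-! ### The same formula on the suspension of the closed ball -/

/-- **`S(Dⁿ⁺¹) → ℝⁿ⁺²`**, `[d, t] ↦ (2√(t(1-t))·d, 2t - 1)`: a continuous map (not injective at the
poles' neighbourhoods' …, but) agreeing with `toSphere` on the equatorial belt `S(Sⁿ) ⊂ S(Dⁿ⁺¹)`.
[folklore] -/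
def ballMap (n : ℕ) : C(Susp ↥(closedBall (0 : 𝔼 (n + 1)) 1), 𝔼 (n + 2)) where
  toFun := Quotient.lift (fun x : ↥(closedBall (0 : 𝔼 (n + 1)) 1) × I => liftVec ((x.1 : 𝔼 (n + 1)), x.2))
    fun x y hxy => liftVec_eq_of_rel hxy
  continuous_toFun := by
    rw [Susp.isQuotientMap_mk.continuous_iff]
    exact continuous_liftVec.comp ((continuous_subtype_val.comp continuous_fst).prodMk continuous_snd)

/-- `ballMap` on points. [folklore] -/
@[simp]
theorem ballMap_mk (x : ↥(closedBall (0 : 𝔼 (n + 1)) 1) × I) :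
    ballMap n (Susp.mk x) = liftVec ((x.1 : 𝔼 (n + 1)), x.2) := rfl

end SuspSphere

end Literature.AlgebraicTopology.Homotopy

end
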